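import Summits.Ventures.CertifiedManyBodySolver.Downfold.EmeryAxialSlabYBCO7PlaneSubsA
import Summits.Ventures.CertifiedManyBodySolver.Downfold.EmeryAxialSlabYBCO7PlaneSubsB
import Summits.Ventures.CertifiedManyBodySolver.Downfold.EmeryFermiFillingLa214
import HarnessLib

/-!
# YBa₂Cu₃O₇ CuO₂ PLANE (box #18Y YBCO7, (K) plane-slice source rows): HOW MUCH AXIAL (Cu-4s / apical) ADMIXTURE DOES THE BOX'S ONE-BAND FERMI SURFACE REQUIRE? — the certified
# co-shift census of the typed 3BE one-body box `emeryBoxYBCO7planeY6K26Src` against its object-E row `t′/t ∈ [-0.63, -0.44]`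

Venture CertifiedManyBodySolver, cell `pub/hubbard-downfold` (stage S1, HUMAN RULINGS D-0096/D-0098: the 3 → 1 reduction error is carried explicitly),
seat hubbard-downfold-mod-4 (technique B = band level); namespace `Summit.Ventures.CertifiedManyBodySolver.Downfold.Emery`. Everything PROVED; numerics
decided by the kernel in `EmeryAxialSlabYBCO7PlaneSubsA`, `EmeryAxialSlabYBCO7PlaneSubsB`.

CONTEXT. `EmeryFermiFillingYBCO7Plane…` certified the σ three-band (d–p_x–p_y + t_pp, t_pp′) Fermi-surface `t′/t` window of this box at its own
hole count and compared it with the box's object-E row (router/BOXES/YBa2Cu3O7.md l.122 «tp/t (E) [−0.63, −0.44]»). `EmeryAxialFermiSurfaceShape` +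
`EmeryAxialConductionBand` (TRANSFER THEOREM `condBand_le_iff`, no separation hypothesis) prove that the four-orbital model of [AndersenEtAl1995] /
[PavariniEtAl2001] — Cu-4s (and through it the apical orbitals) added to the σ model — has, AT ITS FERMI LEVEL, exactly the conduction-band occupied
set, filling and Fermi surface of the σ model with CO-SHIFTED O–O hoppings `(t_pp + a, t_pp′ + a)`, ONE scalar `a = a_F = t_sp²/(ε_s − ε_F) ≥ 0`.
So «how much axial channel does the one-band FS of record require beyond the box's σ rows?» is a one-parameter question, answered here slab by slab
(sub-box rule version B, `EmeryFermiFillingSubBoxB`; edges 0, 0.1, 0.2, 0.25, 0.3, 0.35, 0.4, 0.5 eV; Δ_pd × t_pd split 2 × 2):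

| slab | a (eV) | ε_F window (eV above ε_d) | certified t′/t window | vs E row [-0.63, -0.44] |
|---|---|---|---|---|
| 0 | [0, 0.1] | [1.14, 2.2] | [-0.3615, -0.2514] | SHORT |
| 1 | [0.1, 0.2] | [1.1, 2.14] | [-0.3981, -0.2951] | SHORT |
| 2 | [0.2, 0.25] | [1.1, 2.04] | [-0.4112, -0.3271] | SHORT |
| 3 | [0.25, 0.3] | [1.08, 2.0] | [-0.4255, -0.3411] | SHORT |
| 4 | [0.3, 0.35] | [1.08, 1.98] | [-0.4385, -0.3534] | SHORT |
| 5 | [0.35, 0.4] | [1.06, 1.96] | [-0.4504, -0.3651] | MEETS |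
| 6 | [0.4, 0.5] | [1.02, 1.98] | [-0.4767, -0.3749] | MEETS |

READING (certified, numbers not adjectives): `a ∈ [0, 0.35]` ⇒ the co-shifted Fermi surface is STILL LESS cuprate-like than the E row (`t′/t > -0.44`): the REQUIRED axial admixture at the Fermi level is `a_F > 0.35` eV (`emeryBoxYBCO7planeY6K26Src_axial_short`). The four-orbital form of the exclusion(s) is `emeryBoxYBCO7planeY6K26Src_fourOrbital_short`:
for ANY axial level `ε_s` and coupling `t_sp`, a four-orbital completion of a box point whose conduction band holds the box's electrons at a Fermi level `ε_F < ε_s`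
with `t_sp²/(ε_s − ε_F)` in the excluded range does NOT reproduce the E row. (Pavarini's range parameter for the PURE four-orbital model is
`r = ½/(1 + s)`, `s = (ε_s − ε_F)(ε_F − ε_p)/(2t_sp)² = (ε_F + Δ_pd)/(4·a_total)`, where `a_total` would be the WHOLE O–O co-shift; the box's `t_pp, t_pp′` rows
already contain part of the axial channel when they come from a three-band Wannier fit, so `a_F` here is the ADDITIONAL admixture — a model-form
distance, not a material constant.)

WHAT THIS IS NOT: not a statement that the material's parameters ARE in the box (SCREENING-GRADE provenance); `U = 0` band kinematics; no phase
sentence; the E row is a [float] literature refit. Sources: [AndersenEtAl1995, §§5–6]; [PavariniEtAl2001, Eqs. (1)–(3), Fig. 3];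
[HybertsenSchluterChristensen1989, Eq. (1)].
-/

noncomputable section

namespace Summit.Ventures.CertifiedManyBodySolver.Downfold.Emery

open Real Set
open Summit.Ventures.CertifiedManyBodySolver.Downfold

/-! ## §1 Slab windows (raw co-shifted coordinates `t_pp′ := t_pp + a`, `c′ := t_pp′ + a`) -/

/-- **Slab 0, a ∈ [0, 0.1] eV**: on the co-shifted box (t_pp + a ∈ [0.61, 0.83], t_pp′ + a ∈ [0.15, 0.25]) at per-spin
filling ∈ [0.4175, 0.42]: `ε_F ∈ [1.14, 2.2]` and `t′/t ∈ [-0.3615, -0.2514]` — SHORT vs the E row. [folklore] -/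
theorem ybco7PlaneAxSlab0_window {Δ tpd tpp c ε : ℝ} (hΔ : Δ ∈ Set.Icc (7 / 4 : ℝ) (47 / 20 : ℝ))
    (ha : tpd ∈ Set.Icc (117 / 100 : ℝ) (139 / 100 : ℝ)) (hb : tpp ∈ Set.Icc (61 / 100 : ℝ) (83 / 100 : ℝ))
    (hc : c ∈ Set.Icc (3 / 20 : ℝ) (1 / 4 : ℝ))
    (hν : abFilling Δ tpd tpp c ε ∈ Set.Icc (167 / 400 : ℝ) (21 / 50 : ℝ)) :
    ε ∈ Set.Icc (57 / 50 : ℝ) (11 / 5 : ℝ) ∧ fsRatio Δ tpd tpp c ε ∈ Set.Icc (-(723 / 2000 : ℝ)) (-(1257 / 5000 : ℝ)) := by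
  have hΔ' := hΔ
  constructor
  · clear hΔ
    rcases mem_Icc_split hΔ' (41 / 20 : ℝ) with hΔ' | hΔ'
    · rcases mem_Icc_split ha (32 / 25 : ℝ) with ha' | ha'
      · have h := (ybco7PlaneAx0Sub_0_0 hΔ' ha' hb hc hν).1
        exact ⟨le_trans (by norm_num) h.1, h.2.trans (by norm_num)⟩
      · have h := (ybco7PlaneAx0Sub_0_1 hΔ' ha' hb hc hν).1
        exact ⟨le_trans (by norm_num) h.1, h.2.trans (by norm_num)⟩
    · rcases mem_Icc_split ha (32 / 25 : ℝ) with ha' | ha'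
      · have h := (ybco7PlaneAx0Sub_1_0 hΔ' ha' hb hc hν).1
        exact ⟨le_trans (by norm_num) h.1, h.2.trans (by norm_num)⟩
      · have h := (ybco7PlaneAx0Sub_1_1 hΔ' ha' hb hc hν).1
        exact ⟨le_trans (by norm_num) h.1, h.2.trans (by norm_num)⟩
  · clear hΔ
    rcases mem_Icc_split hΔ' (41 / 20 : ℝ) with hΔ' | hΔ'
    · rcases mem_Icc_split ha (32 / 25 : ℝ) with ha' | ha'
      · have h := (ybco7PlaneAx0Sub_0_0 hΔ' ha' hb hc hν).2
        exact ⟨le_trans (by norm_num) h.1, h.2.trans (by norm_num)⟩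
      · have h := (ybco7PlaneAx0Sub_0_1 hΔ' ha' hb hc hν).2
        exact ⟨le_trans (by norm_num) h.1, h.2.trans (by norm_num)⟩
    · rcases mem_Icc_split ha (32 / 25 : ℝ) with ha' | ha'
      · have h := (ybco7PlaneAx0Sub_1_0 hΔ' ha' hb hc hν).2
        exact ⟨le_trans (by norm_num) h.1, h.2.trans (by norm_num)⟩
      · have h := (ybco7PlaneAx0Sub_1_1 hΔ' ha' hb hc hν).2
        exact ⟨le_trans (by norm_num) h.1, h.2.trans (by norm_num)⟩

/-- **Slab 1, a ∈ [0.1, 0.2] eV**: on the co-shifted box (t_pp + a ∈ [0.71, 0.93], t_pp′ + a ∈ [0.25, 0.35]) at per-spin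
filling ∈ [0.4175, 0.42]: `ε_F ∈ [1.1, 2.14]` and `t′/t ∈ [-0.3981, -0.2951]` — SHORT vs the E row. [folklore] -/
theorem ybco7PlaneAxSlab1_window {Δ tpd tpp c ε : ℝ} (hΔ : Δ ∈ Set.Icc (7 / 4 : ℝ) (47 / 20 : ℝ))
    (ha : tpd ∈ Set.Icc (117 / 100 : ℝ) (139 / 100 : ℝ)) (hb : tpp ∈ Set.Icc (71 / 100 : ℝ) (93 / 100 : ℝ))
    (hc : c ∈ Set.Icc (1 / 4 : ℝ) (7 / 20 : ℝ))
    (hν : abFilling Δ tpd tpp c ε ∈ Set.Icc (167 / 400 : ℝ) (21 / 50 : ℝ)) :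
    ε ∈ Set.Icc (11 / 10 : ℝ) (107 / 50 : ℝ) ∧ fsRatio Δ tpd tpp c ε ∈ Set.Icc (-(3981 / 10000 : ℝ)) (-(2951 / 10000 : ℝ)) := by
  have hΔ' := hΔ
  constructor
  · clear hΔ
    rcases mem_Icc_split hΔ' (41 / 20 : ℝ) with hΔ' | hΔ'
    · rcases mem_Icc_split ha (32 / 25 : ℝ) with ha' | ha'
      · have h := (ybco7PlaneAx1Sub_0_0 hΔ' ha' hb hc hν).1
        exact ⟨le_trans (by norm_num) h.1, h.2.trans (by norm_num)⟩
      · have h := (ybco7PlaneAx1Sub_0_1 hΔ' ha' hb hc hν).1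
        exact ⟨le_trans (by norm_num) h.1, h.2.trans (by norm_num)⟩
    · rcases mem_Icc_split ha (32 / 25 : ℝ) with ha' | ha'
      · have h := (ybco7PlaneAx1Sub_1_0 hΔ' ha' hb hc hν).1
        exact ⟨le_trans (by norm_num) h.1, h.2.trans (by norm_num)⟩
      · have h := (ybco7PlaneAx1Sub_1_1 hΔ' ha' hb hc hν).1
        exact ⟨le_trans (by norm_num) h.1, h.2.trans (by norm_num)⟩
  · clear hΔ
    rcases mem_Icc_split hΔ' (41 / 20 : ℝ) with hΔ' | hΔ'
    · rcases mem_Icc_split ha (32 / 25 : ℝ) with ha' | ha'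
      · have h := (ybco7PlaneAx1Sub_0_0 hΔ' ha' hb hc hν).2
        exact ⟨le_trans (by norm_num) h.1, h.2.trans (by norm_num)⟩
      · have h := (ybco7PlaneAx1Sub_0_1 hΔ' ha' hb hc hν).2
        exact ⟨le_trans (by norm_num) h.1, h.2.trans (by norm_num)⟩
    · rcases mem_Icc_split ha (32 / 25 : ℝ) with ha' | ha'
      · have h := (ybco7PlaneAx1Sub_1_0 hΔ' ha' hb hc hν).2
        exact ⟨le_trans (by norm_num) h.1, h.2.trans (by norm_num)⟩
      · have h := (ybco7PlaneAx1Sub_1_1 hΔ' ha' hb hc hν).2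
        exact ⟨le_trans (by norm_num) h.1, h.2.trans (by norm_num)⟩

/-- **Slab 2, a ∈ [0.2, 0.25] eV**: on the co-shifted box (t_pp + a ∈ [0.81, 0.98], t_pp′ + a ∈ [0.35, 0.4]) at per-spin
filling ∈ [0.4175, 0.42]: `ε_F ∈ [1.1, 2.04]` and `t′/t ∈ [-0.4112, -0.3271]` — SHORT vs the E row. [folklore] -/
theorem ybco7PlaneAxSlab2_window {Δ tpd tpp c ε : ℝ} (hΔ : Δ ∈ Set.Icc (7 / 4 : ℝ) (47 / 20 : ℝ))
    (ha : tpd ∈ Set.Icc (117 / 100 : ℝ) (139 / 100 : ℝ)) (hb : tpp ∈ Set.Icc (81 / 100 : ℝ) (49 / 50 : ℝ))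
    (hc : c ∈ Set.Icc (7 / 20 : ℝ) (2 / 5 : ℝ))
    (hν : abFilling Δ tpd tpp c ε ∈ Set.Icc (167 / 400 : ℝ) (21 / 50 : ℝ)) :
    ε ∈ Set.Icc (11 / 10 : ℝ) (51 / 25 : ℝ) ∧ fsRatio Δ tpd tpp c ε ∈ Set.Icc (-(257 / 625 : ℝ)) (-(3271 / 10000 : ℝ)) := by
  have hΔ' := hΔ
  constructor
  · clear hΔ
    rcases mem_Icc_split hΔ' (41 / 20 : ℝ) with hΔ' | hΔ'
    · rcases mem_Icc_split ha (32 / 25 : ℝ) with ha' | ha'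
      · have h := (ybco7PlaneAx2Sub_0_0 hΔ' ha' hb hc hν).1
        exact ⟨le_trans (by norm_num) h.1, h.2.trans (by norm_num)⟩
      · have h := (ybco7PlaneAx2Sub_0_1 hΔ' ha' hb hc hν).1
        exact ⟨le_trans (by norm_num) h.1, h.2.trans (by norm_num)⟩
    · rcases mem_Icc_split ha (32 / 25 : ℝ) with ha' | ha'
      · have h := (ybco7PlaneAx2Sub_1_0 hΔ' ha' hb hc hν).1
        exact ⟨le_trans (by norm_num) h.1, h.2.trans (by norm_num)⟩
      · have h := (ybco7PlaneAx2Sub_1_1 hΔ' ha' hb hc hν).1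
        exact ⟨le_trans (by norm_num) h.1, h.2.trans (by norm_num)⟩
  · clear hΔ
    rcases mem_Icc_split hΔ' (41 / 20 : ℝ) with hΔ' | hΔ'
    · rcases mem_Icc_split ha (32 / 25 : ℝ) with ha' | ha'
      · have h := (ybco7PlaneAx2Sub_0_0 hΔ' ha' hb hc hν).2
        exact ⟨le_trans (by norm_num) h.1, h.2.trans (by norm_num)⟩
      · have h := (ybco7PlaneAx2Sub_0_1 hΔ' ha' hb hc hν).2
        exact ⟨le_trans (by norm_num) h.1, h.2.trans (by norm_num)⟩
    · rcases mem_Icc_split ha (32 / 25 : ℝ) with ha' | ha'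
      · have h := (ybco7PlaneAx2Sub_1_0 hΔ' ha' hb hc hν).2
        exact ⟨le_trans (by norm_num) h.1, h.2.trans (by norm_num)⟩
      · have h := (ybco7PlaneAx2Sub_1_1 hΔ' ha' hb hc hν).2
        exact ⟨le_trans (by norm_num) h.1, h.2.trans (by norm_num)⟩

/-- **Slab 3, a ∈ [0.25, 0.3] eV**: on the co-shifted box (t_pp + a ∈ [0.86, 1.03], t_pp′ + a ∈ [0.4, 0.45]) at per-spin
filling ∈ [0.4175, 0.42]: `ε_F ∈ [1.08, 2.0]` and `t′/t ∈ [-0.4255, -0.3411]` — SHORT vs the E row. [folklore] -/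
theorem ybco7PlaneAxSlab3_window {Δ tpd tpp c ε : ℝ} (hΔ : Δ ∈ Set.Icc (7 / 4 : ℝ) (47 / 20 : ℝ))
    (ha : tpd ∈ Set.Icc (117 / 100 : ℝ) (139 / 100 : ℝ)) (hb : tpp ∈ Set.Icc (43 / 50 : ℝ) (103 / 100 : ℝ))
    (hc : c ∈ Set.Icc (2 / 5 : ℝ) (9 / 20 : ℝ))
    (hν : abFilling Δ tpd tpp c ε ∈ Set.Icc (167 / 400 : ℝ) (21 / 50 : ℝ)) :
    ε ∈ Set.Icc (27 / 25 : ℝ) (2 : ℝ) ∧ fsRatio Δ tpd tpp c ε ∈ Set.Icc (-(851 / 2000 : ℝ)) (-(3411 / 10000 : ℝ)) := by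
  have hΔ' := hΔ
  constructor
  · clear hΔ
    rcases mem_Icc_split hΔ' (41 / 20 : ℝ) with hΔ' | hΔ'
    · rcases mem_Icc_split ha (32 / 25 : ℝ) with ha' | ha'
      · have h := (ybco7PlaneAx3Sub_0_0 hΔ' ha' hb hc hν).1
        exact ⟨le_trans (by norm_num) h.1, h.2.trans (by norm_num)⟩
      · have h := (ybco7PlaneAx3Sub_0_1 hΔ' ha' hb hc hν).1
        exact ⟨le_trans (by norm_num) h.1, h.2.trans (by norm_num)⟩
    · rcases mem_Icc_split ha (32 / 25 : ℝ) with ha' | ha'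
      · have h := (ybco7PlaneAx3Sub_1_0 hΔ' ha' hb hc hν).1
        exact ⟨le_trans (by norm_num) h.1, h.2.trans (by norm_num)⟩
      · have h := (ybco7PlaneAx3Sub_1_1 hΔ' ha' hb hc hν).1
        exact ⟨le_trans (by norm_num) h.1, h.2.trans (by norm_num)⟩
  · clear hΔ
    rcases mem_Icc_split hΔ' (41 / 20 : ℝ) with hΔ' | hΔ'
    · rcases mem_Icc_split ha (32 / 25 : ℝ) with ha' | ha'
      · have h := (ybco7PlaneAx3Sub_0_0 hΔ' ha' hb hc hν).2
        exact ⟨le_trans (by norm_num) h.1, h.2.trans (by norm_num)⟩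
      · have h := (ybco7PlaneAx3Sub_0_1 hΔ' ha' hb hc hν).2
        exact ⟨le_trans (by norm_num) h.1, h.2.trans (by norm_num)⟩
    · rcases mem_Icc_split ha (32 / 25 : ℝ) with ha' | ha'
      · have h := (ybco7PlaneAx3Sub_1_0 hΔ' ha' hb hc hν).2
        exact ⟨le_trans (by norm_num) h.1, h.2.trans (by norm_num)⟩
      · have h := (ybco7PlaneAx3Sub_1_1 hΔ' ha' hb hc hν).2
        exact ⟨le_trans (by norm_num) h.1, h.2.trans (by norm_num)⟩

/-- **Slab 4, a ∈ [0.3, 0.35] eV**: on the co-shifted box (t_pp + a ∈ [0.91, 1.08], t_pp′ + a ∈ [0.45, 0.5]) at per-spin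
filling ∈ [0.4175, 0.42]: `ε_F ∈ [1.08, 1.98]` and `t′/t ∈ [-0.4385, -0.3534]` — SHORT vs the E row. [folklore] -/
theorem ybco7PlaneAxSlab4_window {Δ tpd tpp c ε : ℝ} (hΔ : Δ ∈ Set.Icc (7 / 4 : ℝ) (47 / 20 : ℝ))
    (ha : tpd ∈ Set.Icc (117 / 100 : ℝ) (139 / 100 : ℝ)) (hb : tpp ∈ Set.Icc (91 / 100 : ℝ) (27 / 25 : ℝ))
    (hc : c ∈ Set.Icc (9 / 20 : ℝ) (1 / 2 : ℝ))
    (hν : abFilling Δ tpd tpp c ε ∈ Set.Icc (167 / 400 : ℝ) (21 / 50 : ℝ)) :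
    ε ∈ Set.Icc (27 / 25 : ℝ) (99 / 50 : ℝ) ∧ fsRatio Δ tpd tpp c ε ∈ Set.Icc (-(877 / 2000 : ℝ)) (-(1767 / 5000 : ℝ)) := by
  have hΔ' := hΔ
  constructor
  · clear hΔ
    rcases mem_Icc_split hΔ' (41 / 20 : ℝ) with hΔ' | hΔ'
    · rcases mem_Icc_split ha (32 / 25 : ℝ) with ha' | ha'
      · have h := (ybco7PlaneAx4Sub_0_0 hΔ' ha' hb hc hν).1
        exact ⟨le_trans (by norm_num) h.1, h.2.trans (by norm_num)⟩
      · have h := (ybco7PlaneAx4Sub_0_1 hΔ' ha' hb hc hν).1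
        exact ⟨le_trans (by norm_num) h.1, h.2.trans (by norm_num)⟩
    · rcases mem_Icc_split ha (32 / 25 : ℝ) with ha' | ha'
      · have h := (ybco7PlaneAx4Sub_1_0 hΔ' ha' hb hc hν).1
        exact ⟨le_trans (by norm_num) h.1, h.2.trans (by norm_num)⟩
      · have h := (ybco7PlaneAx4Sub_1_1 hΔ' ha' hb hc hν).1
        exact ⟨le_trans (by norm_num) h.1, h.2.trans (by norm_num)⟩
  · clear hΔ
    rcases mem_Icc_split hΔ' (41 / 20 : ℝ) with hΔ' | hΔ'
    · rcases mem_Icc_split ha (32 / 25 : ℝ) with ha' | ha'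
      · have h := (ybco7PlaneAx4Sub_0_0 hΔ' ha' hb hc hν).2
        exact ⟨le_trans (by norm_num) h.1, h.2.trans (by norm_num)⟩
      · have h := (ybco7PlaneAx4Sub_0_1 hΔ' ha' hb hc hν).2
        exact ⟨le_trans (by norm_num) h.1, h.2.trans (by norm_num)⟩
    · rcases mem_Icc_split ha (32 / 25 : ℝ) with ha' | ha'
      · have h := (ybco7PlaneAx4Sub_1_0 hΔ' ha' hb hc hν).2
        exact ⟨le_trans (by norm_num) h.1, h.2.trans (by norm_num)⟩
      · have h := (ybco7PlaneAx4Sub_1_1 hΔ' ha' hb hc hν).2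
        exact ⟨le_trans (by norm_num) h.1, h.2.trans (by norm_num)⟩

/-- **Slab 5, a ∈ [0.35, 0.4] eV**: on the co-shifted box (t_pp + a ∈ [0.96, 1.13], t_pp′ + a ∈ [0.5, 0.55]) at per-spin
filling ∈ [0.4175, 0.42]: `ε_F ∈ [1.06, 1.96]` and `t′/t ∈ [-0.4504, -0.3651]` — MEETS vs the E row. [folklore] -/
theorem ybco7PlaneAxSlab5_window {Δ tpd tpp c ε : ℝ} (hΔ : Δ ∈ Set.Icc (7 / 4 : ℝ) (47 / 20 : ℝ))
    (ha : tpd ∈ Set.Icc (117 / 100 : ℝ) (139 / 100 : ℝ)) (hb : tpp ∈ Set.Icc (24 / 25 : ℝ) (113 / 100 : ℝ))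
    (hc : c ∈ Set.Icc (1 / 2 : ℝ) (11 / 20 : ℝ))
    (hν : abFilling Δ tpd tpp c ε ∈ Set.Icc (167 / 400 : ℝ) (21 / 50 : ℝ)) :
    ε ∈ Set.Icc (53 / 50 : ℝ) (49 / 25 : ℝ) ∧ fsRatio Δ tpd tpp c ε ∈ Set.Icc (-(563 / 1250 : ℝ)) (-(3651 / 10000 : ℝ)) := by
  have hΔ' := hΔ
  constructor
  · clear hΔ
    rcases mem_Icc_split hΔ' (41 / 20 : ℝ) with hΔ' | hΔ'
    · rcases mem_Icc_split ha (32 / 25 : ℝ) with ha' | ha'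
      · have h := (ybco7PlaneAx5Sub_0_0 hΔ' ha' hb hc hν).1
        exact ⟨le_trans (by norm_num) h.1, h.2.trans (by norm_num)⟩
      · have h := (ybco7PlaneAx5Sub_0_1 hΔ' ha' hb hc hν).1
        exact ⟨le_trans (by norm_num) h.1, h.2.trans (by norm_num)⟩
    · rcases mem_Icc_split ha (32 / 25 : ℝ) with ha' | ha'
      · have h := (ybco7PlaneAx5Sub_1_0 hΔ' ha' hb hc hν).1
        exact ⟨le_trans (by norm_num) h.1, h.2.trans (by norm_num)⟩
      · have h := (ybco7PlaneAx5Sub_1_1 hΔ' ha' hb hc hν).1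
        exact ⟨le_trans (by norm_num) h.1, h.2.trans (by norm_num)⟩
  · clear hΔ
    rcases mem_Icc_split hΔ' (41 / 20 : ℝ) with hΔ' | hΔ'
    · rcases mem_Icc_split ha (32 / 25 : ℝ) with ha' | ha'
      · have h := (ybco7PlaneAx5Sub_0_0 hΔ' ha' hb hc hν).2
        exact ⟨le_trans (by norm_num) h.1, h.2.trans (by norm_num)⟩
      · have h := (ybco7PlaneAx5Sub_0_1 hΔ' ha' hb hc hν).2
        exact ⟨le_trans (by norm_num) h.1, h.2.trans (by norm_num)⟩
    · rcases mem_Icc_split ha (32 / 25 : ℝ) with ha' | ha'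
      · have h := (ybco7PlaneAx5Sub_1_0 hΔ' ha' hb hc hν).2
        exact ⟨le_trans (by norm_num) h.1, h.2.trans (by norm_num)⟩
      · have h := (ybco7PlaneAx5Sub_1_1 hΔ' ha' hb hc hν).2
        exact ⟨le_trans (by norm_num) h.1, h.2.trans (by norm_num)⟩

/-- **Slab 6, a ∈ [0.4, 0.5] eV**: on the co-shifted box (t_pp + a ∈ [1.01, 1.23], t_pp′ + a ∈ [0.55, 0.65]) at per-spin
filling ∈ [0.4175, 0.42]: `ε_F ∈ [1.02, 1.98]` and `t′/t ∈ [-0.4767, -0.3749]` — MEETS vs the E row. [folklore] -/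
theorem ybco7PlaneAxSlab6_window {Δ tpd tpp c ε : ℝ} (hΔ : Δ ∈ Set.Icc (7 / 4 : ℝ) (47 / 20 : ℝ))
    (ha : tpd ∈ Set.Icc (117 / 100 : ℝ) (139 / 100 : ℝ)) (hb : tpp ∈ Set.Icc (101 / 100 : ℝ) (123 / 100 : ℝ))
    (hc : c ∈ Set.Icc (11 / 20 : ℝ) (13 / 20 : ℝ))
    (hν : abFilling Δ tpd tpp c ε ∈ Set.Icc (167 / 400 : ℝ) (21 / 50 : ℝ)) :
    ε ∈ Set.Icc (51 / 50 : ℝ) (99 / 50 : ℝ) ∧ fsRatio Δ tpd tpp c ε ∈ Set.Icc (-(4767 / 10000 : ℝ)) (-(3749 / 10000 : ℝ)) := by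
  have hΔ' := hΔ
  constructor
  · clear hΔ
    rcases mem_Icc_split hΔ' (41 / 20 : ℝ) with hΔ' | hΔ'
    · rcases mem_Icc_split ha (32 / 25 : ℝ) with ha' | ha'
      · have h := (ybco7PlaneAx6Sub_0_0 hΔ' ha' hb hc hν).1
        exact ⟨le_trans (by norm_num) h.1, h.2.trans (by norm_num)⟩
      · have h := (ybco7PlaneAx6Sub_0_1 hΔ' ha' hb hc hν).1
        exact ⟨le_trans (by norm_num) h.1, h.2.trans (by norm_num)⟩
    · rcases mem_Icc_split ha (32 / 25 : ℝ) with ha' | ha'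
      · have h := (ybco7PlaneAx6Sub_1_0 hΔ' ha' hb hc hν).1
        exact ⟨le_trans (by norm_num) h.1, h.2.trans (by norm_num)⟩
      · have h := (ybco7PlaneAx6Sub_1_1 hΔ' ha' hb hc hν).1
        exact ⟨le_trans (by norm_num) h.1, h.2.trans (by norm_num)⟩
  · clear hΔ
    rcases mem_Icc_split hΔ' (41 / 20 : ℝ) with hΔ' | hΔ'
    · rcases mem_Icc_split ha (32 / 25 : ℝ) with ha' | ha'
      · have h := (ybco7PlaneAx6Sub_0_0 hΔ' ha' hb hc hν).2
        exact ⟨le_trans (by norm_num) h.1, h.2.trans (by norm_num)⟩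
      · have h := (ybco7PlaneAx6Sub_0_1 hΔ' ha' hb hc hν).2
        exact ⟨le_trans (by norm_num) h.1, h.2.trans (by norm_num)⟩
    · rcases mem_Icc_split ha (32 / 25 : ℝ) with ha' | ha'
      · have h := (ybco7PlaneAx6Sub_1_0 hΔ' ha' hb hc hν).2
        exact ⟨le_trans (by norm_num) h.1, h.2.trans (by norm_num)⟩
      · have h := (ybco7PlaneAx6Sub_1_1 hΔ' ha' hb hc hν).2
        exact ⟨le_trans (by norm_num) h.1, h.2.trans (by norm_num)⟩

end Summit.Ventures.CertifiedManyBodySolver.Downfold.Emery
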